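import Mathlib
import Summits.ValiantsHypothesis.ValiantsHypothesis.Theorems.LacunarySymmetroidMatrixDescartesDriftLaw
import Summits.ValiantsHypothesis.ValiantsHypothesis.Theorems.LacunarySymmetroidMatrixDescartesMonotoneExactPencil

/-!
# `MatrixDescartes` (stmt-ValiantsHypothesis-18050) — THE DRIFT LAW AND THE GRAM PARITY LAW IN THE CRUX'S CURRENCY: for a
# pencil `Σ_l X^{d_l}S_l` with non-degenerate middle letter `S_{l₀}` and ARBITRARY other letters,
# `Z₊ ≥ |Δ|` and `Z₊ ≡ Δ (mod 2)` with `Δ = (π(𝒢ₗ) − Σ_{lower} π(S_l)) − (π(𝒢ᵤ) − Σ_{upper} π(S_l))`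

HONEST FRAMING.  Cell `pub-symmetroid`, seat `val-sym-mdr-p2` (gen 21); helper file `--supports` the crux
`Theses.LacunarySymmetroid.MatrixDescartes` (OPEN), NO closure claim; the pencil-currency form of `…DriftLaw`
(`GramDual.drift_le_card_posRoots`, column currency) through the signed column form (`…GramDualPencil`) and the restricted
letter-block-diagonal factorisations (`…MonotoneExactPencil`, `submatrix_mul_of_vanish`).  STRUCTURE theorems — a LOWER bound
and a congruence for the positive root count of a GENERAL pencil whose middle letter is non-degenerate (end letters arbitrary,
e.g. rank one, where the tree's end-inertia law `Inertia.eventually_atTop_indices_eq` does not apply); nothing here bears on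
the crux in its window, `stub_twoSided`, `DoorA26` / `DoorA34`, registers, or `VP ≠ VNP`.

SETTING.  Real symmetric letters `S_l`, `det S_{l₀} ≠ 0`, all other exponents `d_l ≠ d_{l₀}`; UPPER letters `d_l > d_{l₀}`,
LOWER letters `d_l < d_{l₀}`; block Gram matrices of the raw columns `𝒢ᵤ = [S_k S_{l₀}⁻¹ S_l]_{k,l upper}`,
`𝒢ₗ = [S_k S_{l₀}⁻¹ S_l]_{k,l lower}`; `𝕌ᵘ` / `𝕌ˡ` the non-zero eigen-columns of the upper / lower letters (signs = eigenvalues).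

* `card_posCols_eq_sum_posIndex` — `#{upper eigen-columns with positive eigenvalue} = Σ_{upper} π(S_l)` (likewise lower).
* `posIndex_upGram_eq_posIndex_upperBlockGram` / `posIndex_lowGram_eq_posIndex_lowerBlockGram` — `π(𝕌ᵘᵀS_{l₀}⁻¹𝕌ᵘ) = π(𝒢ᵤ)`,
  `π(𝕌ˡᵀS_{l₀}⁻¹𝕌ˡ) = π(𝒢ₗ)` (no sign hypotheses: the factorisations are letter-block-diagonal).
* **`pencil_drift_le_card_posRoots` (THE DRIFT LAW, crux currency).**  If the eigen-column Gram blocks `𝕌ᵘᵀS_{l₀}⁻¹𝕌ᵘ` and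
  `𝕌ˡᵀS_{l₀}⁻¹𝕌ˡ` are non-singular (equivalently `rank 𝒢ᵤ = Σ_{upper} rank S_l`, `rank 𝒢ₗ = Σ_{lower} rank S_l`; see
  `isUnit_det_of_rank_eq_card`), then with `Z₊` the positive zeros of `det(Σ_l X^{d_l}S_l)` counted with multiplicity:
  `π(𝒢ₗ) + Σ_{upper} π(S_l) ≤ π(𝒢ᵤ) + Σ_{lower} π(S_l) + Z₊`, `π(𝒢ᵤ) + Σ_{lower} π(S_l) ≤ π(𝒢ₗ) + Σ_{upper} π(S_l) + Z₊`, and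
  `π(𝒢ₗ) + Σ_{upper} π(S_l) + π(𝒢ᵤ) + Σ_{lower} π(S_l) + Z₊` is EVEN.  (Monotone sector: `Σ_{lower} π = 0`, `Σ_{upper} π = R_U`,
  and the law is the exact count of `…MonotoneExactPencil` read as a bound.)

[folklore] (Sylvester's law of inertia; the inertia walk).  Axioms `propext`, `Classical.choice`, `Quot.sound`.  No definitions.
-/

-- layout Summits/ValiantsHypothesis/ValiantsHypothesis forces the duplicated namespace component
set_option linter.dupNamespace false

namespace Summit.ValiantsHypothesis.ValiantsHypothesis.Theorems.LacunarySymmetroidMatrixDescartes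

open Polynomial Matrix Finset
open scoped BigOperators

namespace GramDual

section DriftPencil

variable {K m : ℕ} (d : Fin K → ℕ) (S : Fin K → Matrix (Fin m) (Fin m) ℝ) (hS : ∀ l, (S l).IsHermitian) (l₀ : Fin K)

/-- the signed column part (file-local notation, as in `…GramDualSigned`) -/
local notation3 (prettyPrint := false) "𝕊[" U ", " σ ", " δ "]" =>
  ((U : Matrix _ _ ℝ).map Polynomial.C
      * Matrix.diagonal (fun j => Polynomial.C ((σ : _ → ℝ) j) * (Polynomial.X : Polynomial ℝ) ^ (δ j : ℕ))
      * ((U : Matrix _ _ ℝ).map Polynomial.C)ᵀ)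

/-- the column type: non-zero eigen-columns of the letters `l ≠ l₀` (file-local notation, as in `…GramDualRank`) -/
local notation3 (prettyPrint := false) "𝕋" =>
  {li : Fin K × Fin m // li.1 ≠ l₀ ∧ (hS li.1).eigenvalues li.2 ≠ 0}

/-- the eigen-column matrix (file-local notation, as in `…GramDualRank`) -/
local notation3 (prettyPrint := false) "𝕌" =>
  (Matrix.of fun (a : Fin m) (t : 𝕋) => ((hS t.1.1).eigenvectorUnitary : Matrix (Fin m) (Fin m) ℝ) a t.1.2)

/-- the eigen-columns of the UPPER letters (file-local notation) -/
local notation3 (prettyPrint := false) "𝕌ᵘ" =>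
  (Matrix.of fun (a : Fin m) (t : {t : 𝕋 // d l₀ < d t.1.1}) => (𝕌) a t.1)

/-- the eigen-columns of the LOWER (= non-upper) letters (file-local notation) -/
local notation3 (prettyPrint := false) "𝕌ˡ" =>
  (Matrix.of fun (a : Fin m) (t : {t : 𝕋 // ¬ d l₀ < d t.1.1}) => (𝕌) a t.1)

/-- the raw column matrix of the letters `l ≠ l₀` (file-local notation, as in `…GramDualRankMDR`) -/
local notation3 (prettyPrint := false) "𝕎" =>
  (Matrix.of fun (a : Fin m) (p : {l : Fin K // l ≠ l₀} × Fin m) => S p.1.1 a p.2)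

/-- the raw columns of the UPPER letters (file-local notation, as in `…MonotoneExactPencil`) -/
local notation3 (prettyPrint := false) "𝕎ᵘ" =>
  (Matrix.of fun (a : Fin m) (p : {l : Fin K // d l₀ < d l} × Fin m) => S p.1.1 a p.2)

/-- the raw columns of the LOWER letters (file-local notation, as in `…MonotoneExactPencil`) -/
local notation3 (prettyPrint := false) "𝕎ˡ" =>
  (Matrix.of fun (a : Fin m) (p : {l : Fin K // d l < d l₀} × Fin m) => S p.1.1 a p.2)

/-! ## §1  Counting positive eigen-columns letter by letter -/

/-- **`#{eigen-columns of the P-letters with positive eigenvalue} = Σ_{P-letters ≠ l₀} π(S_l)`.** [folklore] -/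
theorem card_posCols_eq_sum_posIndex (P : Fin K → Prop) [DecidablePred P] :
    Fintype.card {j : {t : 𝕋 // P t.1.1} // 0 < (hS j.1.1.1).eigenvalues j.1.1.2}
      = ∑ l ∈ Finset.univ.filter (fun l => l ≠ l₀ ∧ P l), Fintype.card {i // 0 < (hS l).eigenvalues i} := by
  classical
  -- flatten the nested subtype
  have e : {j : {t : 𝕋 // P t.1.1} // 0 < (hS j.1.1.1).eigenvalues j.1.1.2}
      ≃ {li : Fin K × Fin m // (li.1 ≠ l₀ ∧ P li.1) ∧ 0 < (hS li.1).eigenvalues li.2} :=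
    { toFun := fun j => ⟨j.1.1.1, ⟨j.1.1.2.1, j.1.2⟩, j.2⟩
      invFun := fun li => ⟨⟨⟨li.1, li.2.1.1, li.2.2.ne'⟩, li.2.1.2⟩, li.2.2⟩
      left_inv := fun j => rfl
      right_inv := fun li => rfl }
  rw [Fintype.card_congr e, Fintype.card_subtype]
  have h : (Finset.univ.filter fun li : Fin K × Fin m => (li.1 ≠ l₀ ∧ P li.1) ∧ 0 < (hS li.1).eigenvalues li.2)
      = (Finset.univ.filter fun l => l ≠ l₀ ∧ P l).biUnion fun l =>
          (Finset.univ.filter fun i : Fin m => 0 < (hS l).eigenvalues i).map ⟨fun i => (l, i), fun i j h => by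
            simpa using h⟩ := by
    ext ⟨l, i⟩
    simp only [Finset.mem_filter, Finset.mem_univ, true_and, Finset.mem_biUnion, Finset.mem_map,
      Function.Embedding.coeFn_mk, Prod.mk.injEq, ne_eq]
    constructor
    · rintro ⟨⟨hl, hP⟩, hi⟩
      exact ⟨l, ⟨hl, hP⟩, i, hi, rfl, rfl⟩
    · rintro ⟨l', ⟨hl', hP'⟩, i', hi', rfl, rfl⟩
      exact ⟨⟨hl', hP'⟩, hi'⟩
  rw [h, Finset.card_biUnion]
  · refine Finset.sum_congr rfl fun l _ => ?_
    rw [Finset.card_map, Fintype.card_subtype]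
  · intro l _ l' _ hll'
    rw [Function.onFun, Finset.disjoint_left]
    intro x hx hx'
    simp only [Finset.mem_map, Finset.mem_filter, Finset.mem_univ, true_and, Function.Embedding.coeFn_mk] at hx hx'
    obtain ⟨i, -, rfl⟩ := hx
    obtain ⟨i', -, h⟩ := hx'
    exact hll' (Prod.mk.inj h).1.symm

/-! ## §2  The positive indices of the upper / lower eigen-column Gram blocks are those of the block Gram matrices -/

include hS in
/-- The upper eigen-column Gram block is hermitian. [folklore] -/
theorem isHermitian_upGram : ((𝕌ᵘ)ᵀ * (S l₀)⁻¹ * 𝕌ᵘ).IsHermitian :=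
  isHermitian_gram (isSymm_of_isHermitian_real (hS l₀)) _

include hS in
/-- The lower eigen-column Gram block is hermitian. [folklore] -/
theorem isHermitian_lowGram : ((𝕌ˡ)ᵀ * (S l₀)⁻¹ * 𝕌ˡ).IsHermitian :=
  isHermitian_gram (isSymm_of_isHermitian_real (hS l₀)) _

/-- **`π(𝕌ᵘᵀS_{l₀}⁻¹𝕌ᵘ) = π(𝒢ᵤ)`** — any letters. [folklore] -/
theorem posIndex_upGram_eq_posIndex_upperBlockGram :
    Fintype.card {j // 0 < (isHermitian_upGram d S hS l₀).eigenvalues j}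
      = Fintype.card {j // 0 < (isHermitian_upperBlockGram d S hS l₀).eigenvalues j} := by
  classical
  have hne : ∀ l : {l : Fin K // d l₀ < d l}, l.1 ≠ l₀ := fun l h => by have := l.2; rw [h] at this; exact lt_irrefl _ this
  set f : {l : Fin K // d l₀ < d l} × Fin m → {l : Fin K // l ≠ l₀} × Fin m := fun p => (⟨p.1.1, hne p.1⟩, p.2) with hf
  have hfinj : Function.Injective f := by
    intro p q h
    simp only [hf, Prod.mk.injEq, Subtype.mk.injEq] at h
    exact Prod.ext (Subtype.ext h.1) h.2
  have hWf : (𝕎).submatrix id f = 𝕎ᵘ := by ext a p; rfl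
  set M := Matrix.of (fun (p : {l : Fin K // l ≠ l₀} × Fin m) (t : 𝕋) =>
    if p.1.1 = t.1.1 then ⇑((hS t.1.1).eigenvectorBasis t.1.2) p.2 / (hS t.1.1).eigenvalues t.1.2 else 0) with hM
  set N := Matrix.of (fun (t : 𝕋) (p : {l : Fin K // l ≠ l₀} × Fin m) =>
    if t.1.1 = p.1.1 then (hS t.1.1).eigenvalues t.1.2 * ⇑((hS t.1.1).eigenvectorBasis t.1.2) p.2 else 0) with hN
  have hUfac : (𝕌ᵘ) = 𝕎ᵘ * M.submatrix f (fun t : {t : 𝕋 // d l₀ < d t.1.1} => t.1) := by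
    have h := submatrix_mul_of_vanish (𝕎) M f hfinj (fun t : {t : 𝕋 // d l₀ < d t.1.1} => t.1) (fun p t hp => by
      simp only [hM, Matrix.of_apply]
      rw [if_neg]
      intro hpt
      have hdp : d l₀ < d p.1.1 := by rw [hpt]; exact t.2
      exact hp (⟨p.1.1, hdp⟩, p.2) (Prod.ext (Subtype.ext rfl) rfl))
    rw [← eigenCols_eq_blockCols_mul S hS l₀, hWf] at h
    rw [← h]
    ext a t; rfl
  have hWfac : (𝕎ᵘ) = 𝕌ᵘ * N.submatrix (fun t : {t : 𝕋 // d l₀ < d t.1.1} => t.1) f := by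
    have h := submatrix_mul_of_vanish (𝕌) N (fun t : {t : 𝕋 // d l₀ < d t.1.1} => t.1) Subtype.val_injective f
      (fun t p ht => by
        simp only [hN, Matrix.of_apply]
        rw [if_neg]
        intro htp
        have hup : d l₀ < d t.1.1 := by rw [htp]; exact p.1.2
        exact ht ⟨t, hup⟩ rfl)
    rw [← blockCols_eq_eigenCols_mul S hS l₀, hWf] at h
    have hsub : (𝕌).submatrix id (fun t : {t : 𝕋 // d l₀ < d t.1.1} => t.1) = 𝕌ᵘ := by ext a t; rfl
    rw [hsub] at h
    exact h
  apply le_antisymm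
  · set M' := M.submatrix f (fun t : {t : 𝕋 // d l₀ < d t.1.1} => t.1) with hM'
    have hG : (𝕌ᵘ)ᵀ * (S l₀)⁻¹ * 𝕌ᵘ = M'ᵀ * ((𝕎ᵘ)ᵀ * (S l₀)⁻¹ * 𝕎ᵘ) * M' := by
      rw [hUfac, Matrix.transpose_mul]; simp only [Matrix.mul_assoc]
    have hGH : (M'ᵀ * ((𝕎ᵘ)ᵀ * (S l₀)⁻¹ * 𝕎ᵘ) * M').IsHermitian := by rw [← hG]; exact isHermitian_upGram d S hS l₀
    rw [Inertia.posIndex_congr (isHermitian_upGram d S hS l₀) hGH hG]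
    exact posIndex_conj_le (isHermitian_upperBlockGram d S hS l₀) M' hGH
  · set N' := N.submatrix (fun t : {t : 𝕋 // d l₀ < d t.1.1} => t.1) f with hN'
    have hG : (𝕎ᵘ)ᵀ * (S l₀)⁻¹ * 𝕎ᵘ = N'ᵀ * ((𝕌ᵘ)ᵀ * (S l₀)⁻¹ * 𝕌ᵘ) * N' := by
      rw [hWfac, Matrix.transpose_mul]; simp only [Matrix.mul_assoc]
    have hGH : (N'ᵀ * ((𝕌ᵘ)ᵀ * (S l₀)⁻¹ * 𝕌ᵘ) * N').IsHermitian := by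
      rw [← hG]; exact isHermitian_upperBlockGram d S hS l₀
    rw [Inertia.posIndex_congr (isHermitian_upperBlockGram d S hS l₀) hGH hG]
    exact posIndex_conj_le (isHermitian_upGram d S hS l₀) N' hGH

/-- **`π(𝕌ˡᵀS_{l₀}⁻¹𝕌ˡ) = π(𝒢ₗ)`** — any letters, all exponents `d_l ≠ d_{l₀}` for `l ≠ l₀`. [folklore] -/
theorem posIndex_lowGram_eq_posIndex_lowerBlockGram (hne : ∀ l, l ≠ l₀ → d l ≠ d l₀) :
    Fintype.card {j // 0 < (isHermitian_lowGram d S hS l₀).eigenvalues j}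
      = Fintype.card {j // 0 < (isHermitian_lowerBlockGram d S hS l₀).eigenvalues j} := by
  classical
  have hne' : ∀ l : {l : Fin K // d l < d l₀}, l.1 ≠ l₀ := fun l h => by have := l.2; rw [h] at this; exact lt_irrefl _ this
  set f : {l : Fin K // d l < d l₀} × Fin m → {l : Fin K // l ≠ l₀} × Fin m := fun p => (⟨p.1.1, hne' p.1⟩, p.2) with hf
  have hfinj : Function.Injective f := by
    intro p q h
    simp only [hf, Prod.mk.injEq, Subtype.mk.injEq] at h
    exact Prod.ext (Subtype.ext h.1) h.2
  have hWf : (𝕎).submatrix id f = 𝕎ˡ := by ext a p; rfl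
  have hlow : ∀ t : 𝕋, ¬ d l₀ < d t.1.1 → d t.1.1 < d l₀ := fun t h =>
    lt_of_le_of_ne (not_lt.1 h) (hne t.1.1 t.2.1)
  set M := Matrix.of (fun (p : {l : Fin K // l ≠ l₀} × Fin m) (t : 𝕋) =>
    if p.1.1 = t.1.1 then ⇑((hS t.1.1).eigenvectorBasis t.1.2) p.2 / (hS t.1.1).eigenvalues t.1.2 else 0) with hM
  set N := Matrix.of (fun (t : 𝕋) (p : {l : Fin K // l ≠ l₀} × Fin m) =>
    if t.1.1 = p.1.1 then (hS t.1.1).eigenvalues t.1.2 * ⇑((hS t.1.1).eigenvectorBasis t.1.2) p.2 else 0) with hN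
  have hUfac : (𝕌ˡ) = 𝕎ˡ * M.submatrix f (fun t : {t : 𝕋 // ¬ d l₀ < d t.1.1} => t.1) := by
    have h := submatrix_mul_of_vanish (𝕎) M f hfinj (fun t : {t : 𝕋 // ¬ d l₀ < d t.1.1} => t.1) (fun p t hp => by
      simp only [hM, Matrix.of_apply]
      rw [if_neg]
      intro hpt
      have hdp : d p.1.1 < d l₀ := by rw [hpt]; exact hlow t.1 t.2
      exact hp (⟨p.1.1, hdp⟩, p.2) (Prod.ext (Subtype.ext rfl) rfl))
    rw [← eigenCols_eq_blockCols_mul S hS l₀, hWf] at h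
    rw [← h]
    ext a t; rfl
  have hWfac : (𝕎ˡ) = 𝕌ˡ * N.submatrix (fun t : {t : 𝕋 // ¬ d l₀ < d t.1.1} => t.1) f := by
    have h := submatrix_mul_of_vanish (𝕌) N (fun t : {t : 𝕋 // ¬ d l₀ < d t.1.1} => t.1) Subtype.val_injective f
      (fun t p ht => by
        simp only [hN, Matrix.of_apply]
        rw [if_neg]
        intro htp
        have hlt : ¬ d l₀ < d t.1.1 := by rw [htp]; exact not_lt.2 p.1.2.le
        exact ht ⟨t, hlt⟩ rfl)
    rw [← blockCols_eq_eigenCols_mul S hS l₀, hWf] at h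
    have hsub : (𝕌).submatrix id (fun t : {t : 𝕋 // ¬ d l₀ < d t.1.1} => t.1) = 𝕌ˡ := by ext a t; rfl
    rw [hsub] at h
    exact h
  apply le_antisymm
  · set M' := M.submatrix f (fun t : {t : 𝕋 // ¬ d l₀ < d t.1.1} => t.1) with hM'
    have hG : (𝕌ˡ)ᵀ * (S l₀)⁻¹ * 𝕌ˡ = M'ᵀ * ((𝕎ˡ)ᵀ * (S l₀)⁻¹ * 𝕎ˡ) * M' := by
      rw [hUfac, Matrix.transpose_mul]; simp only [Matrix.mul_assoc]
    have hGH : (M'ᵀ * ((𝕎ˡ)ᵀ * (S l₀)⁻¹ * 𝕎ˡ) * M').IsHermitian := by rw [← hG]; exact isHermitian_lowGram d S hS l₀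
    rw [Inertia.posIndex_congr (isHermitian_lowGram d S hS l₀) hGH hG]
    exact posIndex_conj_le (isHermitian_lowerBlockGram d S hS l₀) M' hGH
  · set N' := N.submatrix (fun t : {t : 𝕋 // ¬ d l₀ < d t.1.1} => t.1) f with hN'
    have hG : (𝕎ˡ)ᵀ * (S l₀)⁻¹ * 𝕎ˡ = N'ᵀ * ((𝕌ˡ)ᵀ * (S l₀)⁻¹ * 𝕌ˡ) * N' := by
      rw [hWfac, Matrix.transpose_mul]; simp only [Matrix.mul_assoc]
    have hGH : (N'ᵀ * ((𝕌ˡ)ᵀ * (S l₀)⁻¹ * 𝕌ˡ) * N').IsHermitian := by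
      rw [← hG]; exact isHermitian_lowerBlockGram d S hS l₀
    rw [Inertia.posIndex_congr (isHermitian_lowerBlockGram d S hS l₀) hGH hG]
    exact posIndex_conj_le (isHermitian_lowGram d S hS l₀) N' hGH

/-- A real symmetric matrix of full rank is non-singular. [folklore] -/
theorem isUnit_det_of_rank_eq_card {κ' : Type} [Fintype κ'] [DecidableEq κ'] {A : Matrix κ' κ' ℝ} (hA : A.IsHermitian)
    (h : A.rank = Fintype.card κ') : IsUnit A.det := by
  have hcnt := (Inertia.negIndex_add_posIndex_add_corank hA).1
  rw [h, Nat.sub_self, add_zero] at hcnt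
  exact isUnit_iff_ne_zero.2 (Inertia.det_ne_zero_of_indices hA hcnt)

/-! ## §3  The drift law and the Gram parity law for pencils -/

/-- **THE DRIFT LAW AND THE GRAM PARITY LAW (crux currency).**  Real symmetric letters, `det S_{l₀} ≠ 0`, `d_l ≠ d_{l₀}` for
`l ≠ l₀`, non-singular upper / lower eigen-column Gram blocks.  With `Z₊` the positive zeros of `det(Σ_l X^{d_l}S_l)` counted
with multiplicity, `Πᵤ = Σ_{upper} π(S_l)`, `Πₗ = Σ_{lower} π(S_l)`:  `π(𝒢ₗ) + Πᵤ ≤ π(𝒢ᵤ) + Πₗ + Z₊`,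
`π(𝒢ᵤ) + Πₗ ≤ π(𝒢ₗ) + Πᵤ + Z₊`, and `π(𝒢ₗ) + Πᵤ + π(𝒢ᵤ) + Πₗ + Z₊` is even. [folklore] -/
theorem pencil_drift_le_card_posRoots (hS₀ : IsUnit (S l₀).det) (hne : ∀ l, l ≠ l₀ → d l ≠ d l₀)
    (hCᵤu : IsUnit ((𝕌ᵘ)ᵀ * (S l₀)⁻¹ * 𝕌ᵘ).det) (hCₗu : IsUnit ((𝕌ˡ)ᵀ * (S l₀)⁻¹ * 𝕌ˡ).det) :
    Fintype.card {j // 0 < (isHermitian_lowerBlockGram d S hS l₀).eigenvalues j}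
          + ∑ l ∈ Finset.univ.filter (fun l => l ≠ l₀ ∧ d l₀ < d l), Fintype.card {i // 0 < (hS l).eigenvalues i}
        ≤ Fintype.card {j // 0 < (isHermitian_upperBlockGram d S hS l₀).eigenvalues j}
          + ∑ l ∈ Finset.univ.filter (fun l => l ≠ l₀ ∧ ¬ d l₀ < d l), Fintype.card {i // 0 < (hS l).eigenvalues i}
          + Multiset.card ((Matrix.det (∑ l, ((Polynomial.X : Polynomial ℝ) ^ d l) • (S l).map Polynomial.C)).roots.filter
              (fun t => 0 < t))
      ∧ Fintype.card {j // 0 < (isHermitian_upperBlockGram d S hS l₀).eigenvalues j}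
          + ∑ l ∈ Finset.univ.filter (fun l => l ≠ l₀ ∧ ¬ d l₀ < d l), Fintype.card {i // 0 < (hS l).eigenvalues i}
        ≤ Fintype.card {j // 0 < (isHermitian_lowerBlockGram d S hS l₀).eigenvalues j}
          + ∑ l ∈ Finset.univ.filter (fun l => l ≠ l₀ ∧ d l₀ < d l), Fintype.card {i // 0 < (hS l).eigenvalues i}
          + Multiset.card ((Matrix.det (∑ l, ((Polynomial.X : Polynomial ℝ) ^ d l) • (S l).map Polynomial.C)).roots.filter
              (fun t => 0 < t))
      ∧ Even (Fintype.card {j // 0 < (isHermitian_lowerBlockGram d S hS l₀).eigenvalues j}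
          + ∑ l ∈ Finset.univ.filter (fun l => l ≠ l₀ ∧ d l₀ < d l), Fintype.card {i // 0 < (hS l).eigenvalues i}
          + Fintype.card {j // 0 < (isHermitian_upperBlockGram d S hS l₀).eigenvalues j}
          + ∑ l ∈ Finset.univ.filter (fun l => l ≠ l₀ ∧ ¬ d l₀ < d l), Fintype.card {i // 0 < (hS l).eigenvalues i}
          + Multiset.card ((Matrix.det (∑ l, ((Polynomial.X : Polynomial ℝ) ^ d l) • (S l).map Polynomial.C)).roots.filter
              (fun t => 0 < t))) := by
  classical
  -- signed column form, split along the upper / lower letters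
  rw [pencil_eq_base_add_signedPart d S hS l₀]
  have hsplit : 𝕊[𝕌, (fun t : 𝕋 => (hS t.1.1).eigenvalues t.1.2), (fun t : 𝕋 => d t.1.1)]
      = 𝕊[𝕌ᵘ, (fun t : {t : 𝕋 // d l₀ < d t.1.1} => (hS t.1.1.1).eigenvalues t.1.1.2),
          (fun t : {t : 𝕋 // d l₀ < d t.1.1} => d t.1.1.1)]
        + 𝕊[𝕌ˡ, (fun t : {t : 𝕋 // ¬ d l₀ < d t.1.1} => (hS t.1.1.1).eigenvalues t.1.1.2),
          (fun t : {t : 𝕋 // ¬ d l₀ < d t.1.1} => d t.1.1.1)] := by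
    rw [← signedPart_reindex (𝕌) (fun t : 𝕋 => (hS t.1.1).eigenvalues t.1.2) (fun t : 𝕋 => d t.1.1)
      (Equiv.sumCompl fun t : 𝕋 => d l₀ < d t.1.1), submatrix_sumCompl_eq_fromCols, comp_sumCompl_eq_sum_elim,
      comp_sumCompl_eq_sum_elim, signedPart_fromCols]
  rw [hsplit, ← add_assoc]
  have hlow : ∀ t : {t : 𝕋 // ¬ d l₀ < d t.1.1}, d t.1.1.1 < d l₀ := fun t =>
    lt_of_le_of_ne (not_lt.1 t.2) (hne t.1.1.1 t.1.2.1)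
  have h := drift_le_card_posRoots (S l₀) (isSymm_of_isHermitian_real (hS l₀)) hS₀ (𝕌ᵘ) (𝕌ˡ)
    (fun t => (hS t.1.1.1).eigenvalues t.1.1.2) (fun t => (hS t.1.1.1).eigenvalues t.1.1.2)
    (fun t => t.1.2.2) (fun t => t.1.2.2) (d l₀) (fun t => d t.1.1.1) (fun t => d t.1.1.1) (fun t => t.2) hlow
    hCᵤu hCₗu (isHermitian_upGram d S hS l₀) (isHermitian_lowGram d S hS l₀)
  rw [posIndex_upGram_eq_posIndex_upperBlockGram d S hS l₀, posIndex_lowGram_eq_posIndex_lowerBlockGram d S hS l₀ hne,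
    card_posCols_eq_sum_posIndex S hS l₀ (fun l => d l₀ < d l),
    card_posCols_eq_sum_posIndex S hS l₀ (fun l => ¬ d l₀ < d l)] at h
  exact h

end DriftPencil

end GramDual

end Summit.ValiantsHypothesis.ValiantsHypothesis.Theorems.LacunarySymmetroidMatrixDescartes
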